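import Mathlib
import Summits.Ventures.PercRepro2.Defs
import Summits.Ventures.PercRepro2.Harris
import Summits.Ventures.PercRepro2.Graph
import Summits.Ventures.PercRepro2.Events
import Summits.Ventures.PercRepro2.TReduction
import Summits.Ventures.PercRepro2.TReductionBase
import Summits.Ventures.PercRepro2.THBaseEnum
import Summits.Ventures.PercRepro2.THClassVGraph

/-!
# The antipodal base cases of the class-(v) graph as an explicit ten-level enumeration (mine-a g50)

For the class-(v) graph `G₅` (`THClassVGraph`) at the pair `(𝓤, 𝓥) = ({x₆ ∈ T}, {x₄, x₅ ∈ T})`,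
the antipodal base case of a pinning pattern `s : Fin 10 → Fin 3` (`THBaseEnum.kbGen`) is the
explicit ten-level enumeration `enum (s 0) … (s 9)` (`kbGen_eq_enum`, definitionally): a leaf
reads the twenty edge states of the two copies directly and returns the sign
`1_Q(c_σ) (1_U(c_σ) − 1_U(c_σ̄)) (1_e(c_σ) − 1_e(c_σ̄))` as a decision tree (`tree`, `leaf`), so a
kernel evaluation costs `2^{#free}` cheap leaves.  `kform_eq_enum` is `TReduction.kform` at a base
case `(D, a)` in this form.  The three values the antipodal-pair certificate of `THAntipodalPair`
needs: the main base case `enum 2 … 2 = −2` (every edge free: the base-case hypothesis FAILS here)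
and the two antipodal pinnings of the 4-cycle `r–x₄–x₂–x₅` (`r x₄` open, `r x₅` closed,
`x₂ x₄` closed, `x₂ x₅` open, and the reverse), both `= 1`.  No instance, no notation.
-/

namespace Summit.Ventures.PercRepro2

namespace THClassV

open Finset TReduction THBaseEnum

section Leaf

/-- The sign `1_Q (1_U(ω₁) − 1_U(ω₂)) (1_e(ω₁) − 1_e(ω₂))` as a decision tree on the five
Booleans `q = Q(ω₁)`, `u₁ = U(ω₁)`, `u₂ = U(ω₂)`, `e₁ = e(ω₁)`, `e₂ = e(ω₂)`. -/
def tree (q u₁ u₂ e₁ e₂ : Bool) : ℤ :=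
  bif q then (bif u₁ == u₂ then 0 else bif e₁ == e₂ then 0 else bif u₁ == e₁ then 1 else -1)
  else 0

/-- The decision tree is the product of indicators. -/
lemma tree_eq (q u₁ u₂ e₁ e₂ : Bool) : tree q u₁ u₂ e₁ e₂ =
    (if q then 1 else 0) * ((if u₁ then 1 else 0) - (if u₂ then 1 else 0))
      * ((if e₁ then 1 else 0) - (if e₂ then 1 else 0)) := by
  cases q <;> cases u₁ <;> cases u₂ <;> cases e₁ <;> cases e₂ <;> rfl

/-- The leaf: the sign at the two copies `ω₁ = (l2, …, c)`, `ω₂ = (l2', …, c')`, the five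
Booleans computed from the reachability formulas of `THClassVGraph`. -/
def leaf (l2 l3 l4 l5 l6 h2 h3 a b c l2' l3' l4' l5' l6' h2' h3' a' b' c' : Bool) : ℤ :=
  tree (hc l2 l3 l4 l5 l6 h2 h3 a b c)
    (r6 l3 l6 c || (hc l2 l3 l4 l5 l6 h2 h3 a b c && h3 && c))
    (r6 l3' l6' c' || (hc l2' l3' l4' l5' l6' h2' h3' a' b' c' && h3' && c'))
    ((r4 l2 l4 l5 a b || (hc l2 l3 l4 l5 l6 h2 h3 a b c && h2 && a))
      && (r5 l2 l4 l5 a b || (hc l2 l3 l4 l5 l6 h2 h3 a b c && h2 && b)))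
    ((r4 l2' l4' l5' a' b' || (hc l2' l3' l4' l5' l6' h2' h3' a' b' c' && h2' && a'))
      && (r5 l2' l4' l5' a' b' || (hc l2' l3' l4' l5' l6' h2' h3' a' b' c' && h2' && b')))

/-- **The explicit ten-level enumeration** of the antipodal base case of the pinning pattern
`(s0, …, s9)` (`0` closed, `1` open, `2` free). -/
def enum (s0 s1 s2 s3 s4 s5 s6 s7 s8 s9 : Fin 3) : ℤ :=
  ((choices s0).map fun c0 => ((choices s1).map fun c1 => ((choices s2).map fun c2 =>
    ((choices s3).map fun c3 => ((choices s4).map fun c4 => ((choices s5).map fun c5 =>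
    ((choices s6).map fun c6 => ((choices s7).map fun c7 => ((choices s8).map fun c8 =>
    ((choices s9).map fun c9 =>
      leaf c0.1 c1.1 c2.1 c3.1 c4.1 c5.1 c6.1 c7.1 c8.1 c9.1
        c0.2 c1.2 c2.2 c3.2 c4.2 c5.2 c6.2 c7.2 c8.2 c9.2).sum).sum).sum).sum).sum).sum).sum).sum).sum).sum

/-- The leaf function on configurations. -/
def termTree (ω₁ ω₂ : Config (Fin 10)) : ℤ := tree (qB ω₁) (uB ω₁) (uB ω₂) (eB ω₁) (eB ω₂)

/-- `termTree` is `THBaseEnum.termOf` of the three deciders. -/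
lemma termTree_eq : termTree = termOf qB uB eB := by
  funext ω₁ ω₂
  exact tree_eq _ _ _ _ _

/-- **The nested enumerator of `THBaseEnum` is the explicit enumeration** (definitionally). -/
lemma kbGen_eq_enum (s : Fin 10 → Fin 3) :
    kbGen 10 s termTree = enum (s 0) (s 1) (s 2) (s 3) (s 4) (s 5) (s 6) (s 7) (s 8) (s 9) := rfl

end Leaf

section Bridge

variable {R : Type*} [Field R] [DecidableEq R]

/-- **`kform` at a base case `(D, a)` is the explicit enumeration** of the pattern
`stateOf D a`. -/
theorem kform_eq_enum (D : Finset (Fin 10)) (a : Fin 10 → R)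
    (ha : ∀ x, x ∉ D → a x = 0 ∨ a x = 1) :
    kform Q U e D a =
      ((enum (stateOf D a 0) (stateOf D a 1) (stateOf D a 2) (stateOf D a 3) (stateOf D a 4)
        (stateOf D a 5) (stateOf D a 6) (stateOf D a 7) (stateOf D a 8) (stateOf D a 9) : ℤ) : R) := by
  rw [kform_eq_kbGen Q U e qB uB eB mem_Q_iff mem_U_iff mem_e_iff D a ha, ← termTree_eq,
    kbGen_eq_enum]

end Bridge

section Values

/-- **The main base case is `−2`**: every edge free. -/
lemma enum_main : enum 2 2 2 2 2 2 2 2 2 2 = -2 := by decide +kernel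

/-- **The certificate pinning**: `r x₄` open, `r x₅` closed, `x₂ x₄` closed, `x₂ x₅` open
(edges `2, 3, 7, 8`), the rest free: the base case is `1`. -/
lemma enum_cert : enum 2 2 1 0 2 2 2 0 1 2 = 1 := by decide +kernel

/-- **Its antipode**: `r x₄` closed, `r x₅` open, `x₂ x₄` open, `x₂ x₅` closed: the base case
is `1`. -/
lemma enum_cert' : enum 2 2 0 1 2 2 2 1 0 2 = 1 := by decide +kernel

end Values

end THClassV

end Summit.Ventures.PercRepro2
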